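import Summits.MatrixMultiplication.MatrixMultiplication.Theorems.SubgroupIdentityDesigns.Negative.CornerSums
import Summits.MatrixMultiplication.MatrixMultiplication.Theorems.SubgroupIdentityDesigns.Negative.PairIndependence
import Summits.MatrixMultiplication.MatrixMultiplication.Theorems.LevelOneGL2Designs.Negative.LevelSpace

/-!
# The rectangle law (negative lemmas for the crux `SubgroupIdentityDesigns`,
# stmt-MatrixMultiplication-14079) — VALUE = THEOREM (all p, explicit certificate), NOT summit
# progress; the crux stays open.

A simpler and stronger certificate than the corner certificate of `OppositeCorners` /
`CornerGrid`.  The Borel cells `B(α, β) = {[[α, x],[0, β]] : x ∈ 𝔽_p}` (`p` points each) have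
level-1 sums `Σ_x ψ(tr(M·[[α,x],[0,β]])) = p·[M₁₀ = 0]·ψ(M₀₀α + M₁₁β)`, and a rank `≤ 1` matrix
with `M₁₀ = 0` has `M₀₀ = 0` or `M₁₁ = 0`; hence for every RECTANGLE `{ε, ε'} × {δ, δ'}`
(`ε ≠ ε'`, `δ ≠ δ'`, all non-zero) the `±1` combination

  `λ = 1_{B(ε,δ)} - 1_{B(ε',δ)} - 1_{B(ε,δ')} + 1_{B(ε',δ')}`

is a NON-ZERO annihilator of the level-1 space (`exists_urect_annihilator`; the lower twin
follows by the Weyl conjugation).  By pair independence (`PairIndependence`), a subgroup-TPP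
triple with a level-1 identity test admits no non-zero level-1 annihilator supported on a
product set `HᵢHⱼ` (`i < j`).  The cells lie in `HᵢHⱼ` as soon as ONE of `Hᵢ, Hⱼ` contains `U⁺` and the four
diagonal matrices `diag(ε,δ), diag(ε',δ), diag(ε,δ'), diag(ε',δ')` are products `a b`
(`a ∈ Hᵢ`, `b ∈ Hⱼ`) — `urect_cells_of_left/right`.  RECTANGLE LAW (`no_idTest_urect₁₂` … and
the crux-vocabulary `no_levelOne_design_rect₁₂/₁₃`): e.g. if `H₁ ⊇ U⁺ ∪ {diag(e,1)}` and
`Hⱼ ∋ diag(1,q)` (`e, q ∉ {0,1}`, `j = 2` or `3`), no subgroup-TPP triple `(H₁, H₂, H₃)` carries a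
level-1 identity design.  Compared with `OppositeCorners` the partner needs ONE diagonal element,
not a `U⁻`-coset; this kills the frame survivor through its pairs `(K₁, S)`, `(K₂, S)` as well
(`S ∋ diag(1, q)`, `q` a square), matching the LP certificates of job j110106.
-/

set_option linter.dupNamespace false

noncomputable section

open scoped BigOperators Classical
open Summit.MatrixMultiplication.MatrixMultiplication.Theorems.LieRankDesigns.Negative
  (GLm Mat fourierFn)
open Summit.MatrixMultiplication.MatrixMultiplication.Theorems.LevelOneGL2Designs.Negative
  (levelSubmodule mem_levelSubmodule_iff levelSubmodule_bi_inv fourierFn_mem_levelSubmodule)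

namespace Summit.MatrixMultiplication.MatrixMultiplication.Theorems.SubgroupIdentityDesigns.Negative

section RectangleLaw

open Literature.Barriers.MatrixMultiplication (SubgroupTPP)

variable {p : ℕ} [hp : Fact p.Prime]

/-- Equality of upper-triangular `2 × 2` matrices is equality of the three free entries. -/
theorem ucell_eq_iff (a b d a' b' d' : ZMod p) :
    (!![a, b; 0, d] : Mat p 2) = !![a', b'; 0, d'] ↔ a = a' ∧ b = b' ∧ d = d' := by
  constructor
  · intro h
    exact ⟨by simpa using congrFun (congrFun h 0) 0, by simpa using congrFun (congrFun h 0) 1,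
      by simpa using congrFun (congrFun h 1) 1⟩
  · rintro ⟨rfl, rfl, rfl⟩; rfl

/-- Level-1 sum over an upper Borel cell: `Σ_x ψ(tr(M·[[α,x],[0,β]])) = ψ(M₀₀α+M₁₁β)·p[M₁₀=0]`. -/
theorem ucell_sum (M : Mat p 2) (α β : ZMod p) :
    ∑ x : ZMod p, ZMod.stdAddChar (Matrix.trace (M * !![α, x; 0, β])) =
      ZMod.stdAddChar (M 0 0 * α + M 1 1 * β) * (if M 1 0 = 0 then (p : ℂ) else 0) := by
  have h : ∀ x : ZMod p, Matrix.trace (M * !![α, x; 0, β]) = (M 0 0 * α + M 1 1 * β) +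
      x * M 1 0 := by
    intro x
    simp [Matrix.trace, Matrix.mul_apply, Fin.sum_univ_two]
    ring
  simp_rw [h, AddChar.map_add_eq_mul, ← Finset.mul_sum, sum_psi_mul_right]

/-- **Rectangle bracket (upper).**  For `det M = 0` the `±1` combination of the four cell sums
over a rectangle `{ε, ε'} × {δ, δ'}` vanishes. -/
theorem ucell_bracket (M : Mat p 2) (hM : M.det = 0) (ε ε' δ δ' : ZMod p) :
    (∑ x : ZMod p, ZMod.stdAddChar (Matrix.trace (M * !![ε, x; 0, δ])))
      - (∑ x : ZMod p, ZMod.stdAddChar (Matrix.trace (M * !![ε', x; 0, δ])))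
      - (∑ x : ZMod p, ZMod.stdAddChar (Matrix.trace (M * !![ε, x; 0, δ'])))
      + (∑ x : ZMod p, ZMod.stdAddChar (Matrix.trace (M * !![ε', x; 0, δ']))) = 0 := by
  rw [ucell_sum, ucell_sum, ucell_sum, ucell_sum]
  by_cases h10 : M 1 0 = 0
  · have h : M 0 0 * M 1 1 = 0 := by
      rw [Matrix.det_fin_two, h10, mul_zero, sub_zero] at hM; exact hM
    rcases mul_eq_zero.1 h with h0 | h0
    · simp only [h0, zero_mul, zero_add]; ring
    · simp only [h0, zero_mul, add_zero]; ring
  · simp [h10]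

/-- Push-forward of an upper cell indicator through a level-1 function. -/
theorem ucell_push (α β : ZMod p) (h : α * β ≠ 0) (c : Mat p 2 → ℂ) :
    ∑ g : GLm p 2, (∑ x : ZMod p, if (g : Mat p 2) = !![α, x; 0, β] then (1 : ℂ) else 0) *
        fourierFn c g =
      ∑ M : Mat p 2, c M * ∑ x : ZMod p, ZMod.stdAddChar (Matrix.trace (M * !![α, x; 0, β])) := by
  have hdet : ∀ x : ZMod p, Matrix.det !![α, x; 0, β] ≠ 0 := by
    intro x; rw [Matrix.det_fin_two_of]; simpa using h
  calc ∑ g : GLm p 2, (∑ x : ZMod p, if (g : Mat p 2) = !![α, x; 0, β] then (1 : ℂ) else 0) *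
          fourierFn c g
      = ∑ x : ZMod p, ∑ g : GLm p 2,
          (if (g : Mat p 2) = !![α, x; 0, β] then fourierFn c g else 0) := by
        simp_rw [Finset.sum_mul, ite_mul, one_mul, zero_mul]
        rw [Finset.sum_comm]
    _ = ∑ x : ZMod p, ∑ M : Mat p 2,
          c M * ZMod.stdAddChar (Matrix.trace (M * !![α, x; 0, β])) := by
        refine Finset.sum_congr rfl fun x _ => ?_
        rw [sum_ite_coe_eq _ (hdet x)]
        rfl
    _ = ∑ M : Mat p 2, c M * ∑ x : ZMod p,
          ZMod.stdAddChar (Matrix.trace (M * !![α, x; 0, β])) := by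
        rw [Finset.sum_comm]
        refine Finset.sum_congr rfl fun M _ => ?_
        rw [Finset.mul_sum]

/-- **THE UPPER RECTANGLE ANNIHILATOR.**  For a rectangle `{ε, ε'} × {δ, δ'}` of non-zero
scalars (`ε ≠ ε'`, `δ ≠ δ'`) there is a NON-ZERO function annihilating every level-1 function on
`GL_2(𝔽_p)` and supported on the four upper Borel cells `{[[α, x],[0, β]]}`,
`α ∈ {ε, ε'}`, `β ∈ {δ, δ'}`. -/
theorem exists_urect_annihilator {ε ε' δ δ' : ZMod p} (hε : ε ≠ 0) (hε' : ε' ≠ 0) (hδ : δ ≠ 0)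
    (hδ' : δ' ≠ 0) (hεε' : ε ≠ ε') (hδδ' : δ ≠ δ') :
    ∃ lam : GLm p 2 → ℂ, lam ≠ 0 ∧
      (∀ g, lam g ≠ 0 → ∃ α β x : ZMod p, (α = ε ∨ α = ε') ∧ (β = δ ∨ β = δ') ∧
        (g : Mat p 2) = !![α, x; 0, β]) ∧
      ∀ F ∈ levelSubmodule p 2 1, ∑ g, lam g * F g = 0 := by
  refine ⟨fun g =>
      (∑ x : ZMod p, if (g : Mat p 2) = !![ε, x; 0, δ] then (1 : ℂ) else 0)
      - (∑ x : ZMod p, if (g : Mat p 2) = !![ε', x; 0, δ] then (1 : ℂ) else 0)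
      - (∑ x : ZMod p, if (g : Mat p 2) = !![ε, x; 0, δ'] then (1 : ℂ) else 0)
      + (∑ x : ZMod p, if (g : Mat p 2) = !![ε', x; 0, δ'] then (1 : ℂ) else 0), ?_, ?_, ?_⟩
  · -- non-zero: value `1` at `diag(ε, δ)`
    intro h
    have hd : Matrix.det !![ε, (0 : ZMod p); 0, δ] ≠ 0 := by
      rw [Matrix.det_fin_two_of]; simpa using And.intro hε hδ
    have h0 := congrFun h (Matrix.GeneralLinearGroup.mkOfDetNeZero _ hd)
    have hc : ((Matrix.GeneralLinearGroup.mkOfDetNeZero _ hd : GLm p 2) : Mat p 2) =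
        !![ε, 0; 0, δ] := rfl
    simp only [hc, ucell_eq_iff, Pi.zero_apply] at h0
    simp [hεε', hδδ', Finset.sum_ite_eq] at h0
  · -- support
    intro g hg
    by_contra hne
    apply hg
    have h0 : ∀ α β : ZMod p, (α = ε ∨ α = ε') → (β = δ ∨ β = δ') →
        (∑ x : ZMod p, if (g : Mat p 2) = !![α, x; 0, β] then (1 : ℂ) else 0) = 0 := by
      intro α β hα hβ
      exact Finset.sum_eq_zero fun x _ => if_neg fun h => hne ⟨α, β, x, hα, hβ, h⟩
    simp only [h0 ε δ (Or.inl rfl) (Or.inl rfl), h0 ε' δ (Or.inr rfl) (Or.inl rfl),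
      h0 ε δ' (Or.inl rfl) (Or.inr rfl), h0 ε' δ' (Or.inr rfl) (Or.inr rfl), sub_zero, add_zero]
  · -- annihilation
    intro F hF
    obtain ⟨c, hc, hFc⟩ := mem_levelSubmodule_iff.mp hF
    have hF' : F = fourierFn c := funext hFc
    subst hF'
    simp only [sub_mul, add_mul, Finset.sum_sub_distrib, Finset.sum_add_distrib]
    rw [ucell_push ε δ (mul_ne_zero hε hδ) c, ucell_push ε' δ (mul_ne_zero hε' hδ) c,
      ucell_push ε δ' (mul_ne_zero hε hδ') c, ucell_push ε' δ' (mul_ne_zero hε' hδ') c,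
      ← Finset.sum_sub_distrib, ← Finset.sum_sub_distrib, ← Finset.sum_add_distrib]
    refine Finset.sum_eq_zero fun M _ => ?_
    rw [← mul_sub, ← mul_sub, ← mul_add]
    by_cases hM : M.det = 0
    · rw [ucell_bracket M hM, mul_zero]
    · rw [hc M (one_lt_rank_of_det_ne_zero M hM), zero_mul]

/-- Pair independence with a non-zero annihilator: a level-1 annihilator `λ ≠ 0` supported on a
product set `HᵢHⱼ` (`i < j`) of a subgroup-TPP triple excludes every level-1 identity test. -/
theorem no_idTest_of_ne_zero_annihilator {H₁ H₂ H₃ : Subgroup (GLm p 2)}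
    (htpp : SubgroupTPP H₁ H₂ H₃) (lam : GLm p 2 → ℂ) (h1 : lam ≠ 0)
    (hann : ∀ F ∈ levelSubmodule p 2 1, ∑ g, lam g * F g = 0)
    (hsupp : (∀ g, lam g ≠ 0 → ∃ a ∈ H₁, ∃ b ∈ H₂, g = a * b) ∨
      (∀ g, lam g ≠ 0 → ∃ a ∈ H₁, ∃ c ∈ H₃, g = a * c) ∨
      (∀ g, lam g ≠ 0 → ∃ b ∈ H₂, ∃ c ∈ H₃, g = b * c)) :
    ¬ ∃ f ∈ levelSubmodule p 2 1, f 1 = 1 ∧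
      ∀ a ∈ H₁, ∀ b ∈ H₂, ∀ c ∈ H₃, a * b * c ≠ 1 → f (a * b * c) = 0 := by
  rintro ⟨f, hf, hf1, hf0⟩
  rcases hsupp with h | h | h
  · exact h1 (eq_zero_of_annihilator_on_left (levelSubmodule p 2 1)
      levelSubmodule_bi_inv htpp hf hf1 hf0 lam h hann)
  · exact h1 (eq_zero_of_annihilator_on_outer (levelSubmodule p 2 1)
      levelSubmodule_bi_inv htpp hf hf1 hf0 lam h hann)
  · exact h1 (eq_zero_of_annihilator_on_right (levelSubmodule p 2 1)
      levelSubmodule_bi_inv htpp hf hf1 hf0 lam h hann)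

/-- Upper cells from the LEFT factor: if `U⁺ ≤ Hᵢ` and `diag(α, β) = a b` (`a ∈ Hᵢ`, `b ∈ Hⱼ`),
every `[[α, x],[0, β]]` is such a product. -/
theorem ucell_of_left {Hi Hj : Subgroup (GLm p 2)}
    (hU : ∀ u : GLm p 2, (u : Mat p 2) 1 0 = 0 → (u : Mat p 2) 0 0 = 1 → (u : Mat p 2) 1 1 = 1 →
      u ∈ Hi)
    {α β : ZMod p} (hβ : β ≠ 0)
    (hdiag : ∃ a ∈ Hi, ∃ b ∈ Hj, ((a * b : GLm p 2) : Mat p 2) = !![α, 0; 0, β]) (x : ZMod p) :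
    ∃ a ∈ Hi, ∃ b ∈ Hj, ((a * b : GLm p 2) : Mat p 2) = !![α, x; 0, β] := by
  obtain ⟨a, ha, b, hb, hab⟩ := hdiag
  obtain ⟨u, hu⟩ : ∃ u : GLm p 2, (u : Mat p 2) = !![1, x / β; 0, 1] :=
    ⟨Matrix.GeneralLinearGroup.mkOfDetNeZero _ (by rw [Matrix.det_fin_two_of]; simp), rfl⟩
  refine ⟨u * a, Hi.mul_mem (hU u (by simp [hu]) (by simp [hu]) (by simp [hu])) ha, b, hb, ?_⟩
  rw [mul_assoc, Units.val_mul, hab, hu, Matrix.mul_fin_two]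
  ext i j
  fin_cases i <;> fin_cases j <;> simp [div_mul_cancel₀ _ hβ]

/-- Upper cells from the RIGHT factor: if `U⁺ ≤ Hⱼ` and `diag(α, β) = a b` (`a ∈ Hᵢ`, `b ∈ Hⱼ`),
every `[[α, x],[0, β]]` is such a product. -/
theorem ucell_of_right {Hi Hj : Subgroup (GLm p 2)}
    (hU : ∀ u : GLm p 2, (u : Mat p 2) 1 0 = 0 → (u : Mat p 2) 0 0 = 1 → (u : Mat p 2) 1 1 = 1 →
      u ∈ Hj)
    {α β : ZMod p} (hα : α ≠ 0)
    (hdiag : ∃ a ∈ Hi, ∃ b ∈ Hj, ((a * b : GLm p 2) : Mat p 2) = !![α, 0; 0, β]) (x : ZMod p) :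
    ∃ a ∈ Hi, ∃ b ∈ Hj, ((a * b : GLm p 2) : Mat p 2) = !![α, x; 0, β] := by
  obtain ⟨a, ha, b, hb, hab⟩ := hdiag
  obtain ⟨u, hu⟩ : ∃ u : GLm p 2, (u : Mat p 2) = !![1, x / α; 0, 1] :=
    ⟨Matrix.GeneralLinearGroup.mkOfDetNeZero _ (by rw [Matrix.det_fin_two_of]; simp), rfl⟩
  refine ⟨a, ha, b * u, Hj.mul_mem hb (hU u (by simp [hu]) (by simp [hu]) (by simp [hu])), ?_⟩
  rw [← mul_assoc, Units.val_mul, hab, hu, Matrix.mul_fin_two]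
  ext i j
  fin_cases i <;> fin_cases j <;> simp [mul_div_cancel₀ _ hα]

/-- **RECTANGLE LAW, pair `(H₁, H₂)`, upper cells.**  If every upper cell over the rectangle
`{ε, ε'} × {δ, δ'}` (non-zero, `ε ≠ ε'`, `δ ≠ δ'`) consists of products `a b`, `a ∈ H₁`,
`b ∈ H₂`, a subgroup-TPP triple `(H₁, H₂, H₃)` has no level-1 identity test. -/
theorem no_idTest_urect₁₂ {H₁ H₂ H₃ : Subgroup (GLm p 2)} (htpp : SubgroupTPP H₁ H₂ H₃)
    {ε ε' δ δ' : ZMod p} (hε : ε ≠ 0) (hε' : ε' ≠ 0) (hδ : δ ≠ 0) (hδ' : δ' ≠ 0)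
    (hεε' : ε ≠ ε') (hδδ' : δ ≠ δ')
    (hcell : ∀ α β : ZMod p, (α = ε ∨ α = ε') → (β = δ ∨ β = δ') → ∀ x : ZMod p,
      ∃ a ∈ H₁, ∃ b ∈ H₂, ((a * b : GLm p 2) : Mat p 2) = !![α, x; 0, β]) :
    ¬ ∃ f ∈ levelSubmodule p 2 1, f 1 = 1 ∧
      ∀ a ∈ H₁, ∀ b ∈ H₂, ∀ c ∈ H₃, a * b * c ≠ 1 → f (a * b * c) = 0 := by
  obtain ⟨lam, h1, hsupp, hann⟩ := exists_urect_annihilator hε hε' hδ hδ' hεε' hδδ'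
  refine no_idTest_of_ne_zero_annihilator htpp lam h1 hann (Or.inl fun g hg => ?_)
  obtain ⟨α, β, x, hα, hβ, hgx⟩ := hsupp g hg
  obtain ⟨a, ha, b, hb, hab⟩ := hcell α β hα hβ x
  exact ⟨a, ha, b, hb, Units.ext (hgx.trans hab.symm)⟩

/-- **RECTANGLE LAW, pair `(H₁, H₃)`, upper cells.** -/
theorem no_idTest_urect₁₃ {H₁ H₂ H₃ : Subgroup (GLm p 2)} (htpp : SubgroupTPP H₁ H₂ H₃)
    {ε ε' δ δ' : ZMod p} (hε : ε ≠ 0) (hε' : ε' ≠ 0) (hδ : δ ≠ 0) (hδ' : δ' ≠ 0)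
    (hεε' : ε ≠ ε') (hδδ' : δ ≠ δ')
    (hcell : ∀ α β : ZMod p, (α = ε ∨ α = ε') → (β = δ ∨ β = δ') → ∀ x : ZMod p,
      ∃ a ∈ H₁, ∃ c ∈ H₃, ((a * c : GLm p 2) : Mat p 2) = !![α, x; 0, β]) :
    ¬ ∃ f ∈ levelSubmodule p 2 1, f 1 = 1 ∧
      ∀ a ∈ H₁, ∀ b ∈ H₂, ∀ c ∈ H₃, a * b * c ≠ 1 → f (a * b * c) = 0 := by
  obtain ⟨lam, h1, hsupp, hann⟩ := exists_urect_annihilator hε hε' hδ hδ' hεε' hδδ'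
  refine no_idTest_of_ne_zero_annihilator htpp lam h1 hann (Or.inr (Or.inl fun g hg => ?_))
  obtain ⟨α, β, x, hα, hβ, hgx⟩ := hsupp g hg
  obtain ⟨a, ha, c, hc, hac⟩ := hcell α β hα hβ x
  exact ⟨a, ha, c, hc, Units.ext (hgx.trans hac.symm)⟩

/-- **RECTANGLE LAW, pair `(H₂, H₃)`, upper cells.** -/
theorem no_idTest_urect₂₃ {H₁ H₂ H₃ : Subgroup (GLm p 2)} (htpp : SubgroupTPP H₁ H₂ H₃)
    {ε ε' δ δ' : ZMod p} (hε : ε ≠ 0) (hε' : ε' ≠ 0) (hδ : δ ≠ 0) (hδ' : δ' ≠ 0)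
    (hεε' : ε ≠ ε') (hδδ' : δ ≠ δ')
    (hcell : ∀ α β : ZMod p, (α = ε ∨ α = ε') → (β = δ ∨ β = δ') → ∀ x : ZMod p,
      ∃ b ∈ H₂, ∃ c ∈ H₃, ((b * c : GLm p 2) : Mat p 2) = !![α, x; 0, β]) :
    ¬ ∃ f ∈ levelSubmodule p 2 1, f 1 = 1 ∧
      ∀ a ∈ H₁, ∀ b ∈ H₂, ∀ c ∈ H₃, a * b * c ≠ 1 → f (a * b * c) = 0 := by
  obtain ⟨lam, h1, hsupp, hann⟩ := exists_urect_annihilator hε hε' hδ hδ' hεε' hδδ'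
  refine no_idTest_of_ne_zero_annihilator htpp lam h1 hann (Or.inr (Or.inr fun g hg => ?_))
  obtain ⟨α, β, x, hα, hβ, hgx⟩ := hsupp g hg
  obtain ⟨b, hb, c, hc, hbc⟩ := hcell α β hα hβ x
  exact ⟨b, hb, c, hc, Units.ext (hgx.trans hbc.symm)⟩

/-- **Two generators suffice.**  If `H₁ ⊇ U⁺`, `s ∈ H₁` with `s = diag(e, 1)` and `t ∈ Hⱼ` with
`t = diag(1, q)` (`e, q ∉ {0, 1}`), then the rectangle `{1, e} × {1, q}` lies in `H₁Hⱼ`: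
`diag(α, β) = a b` for all `α ∈ {1, e}`, `β ∈ {1, q}`. -/
theorem rect_of_generators {H₁ Hj : Subgroup (GLm p 2)} {e q : ZMod p} {s t : GLm p 2}
    (hs : s ∈ H₁) (hse : (s : Mat p 2) = !![e, 0; 0, 1]) (ht : t ∈ Hj)
    (htq : (t : Mat p 2) = !![1, 0; 0, q]) :
    ∀ α β : ZMod p, (α = 1 ∨ α = e) → (β = 1 ∨ β = q) →
      ∃ a ∈ H₁, ∃ b ∈ Hj, ((a * b : GLm p 2) : Mat p 2) = !![α, 0; 0, β] := by
  have hmul : ∀ a b : GLm p 2, ∀ x y : ZMod p, (a : Mat p 2) = !![x, 0; 0, 1] →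
      (b : Mat p 2) = !![1, 0; 0, y] → ((a * b : GLm p 2) : Mat p 2) = !![x, 0; 0, y] := by
    intro a b x y ha hb
    rw [Units.val_mul, ha, hb, Matrix.mul_fin_two]
    ext i j; fin_cases i <;> fin_cases j <;> simp
  have h1 : ((1 : GLm p 2) : Mat p 2) = !![1, 0; 0, 1] := by
    rw [Units.val_one]; ext i j; fin_cases i <;> fin_cases j <;> simp
  intro α β hα hβ
  rcases hα with hα | hα <;> rcases hβ with hβ | hβ <;> rw [hα, hβ]
  · exact ⟨1, H₁.one_mem, 1, Hj.one_mem, hmul 1 1 1 1 h1 h1⟩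
  · exact ⟨1, H₁.one_mem, t, ht, hmul 1 t 1 q h1 htq⟩
  · exact ⟨s, hs, 1, Hj.one_mem, hmul s 1 e 1 hse h1⟩
  · exact ⟨s, hs, t, ht, hmul s t e q hse htq⟩

/-- **RECTANGLE LAW in the crux's vocabulary, partner `H₂`.**  If `H₁ ⊇ U⁺`, `H₁ ∋ diag(e,1)`
and `H₂ ∋ diag(1, q)` with `e, q ∉ {0, 1}`, no subgroup-TPP triple `(H₁, H₂, H₃)` of `GL_2(𝔽_p)`
satisfies the identity-design clause of `SubgroupIdentityDesigns` at level `1`. -/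
theorem no_levelOne_design_rect₁₂ {H₁ H₂ H₃ : Subgroup (GLm p 2)} {e q : ZMod p}
    (he0 : e ≠ 0) (he1 : e ≠ 1) (hq0 : q ≠ 0) (hq1 : q ≠ 1)
    (hU : ∀ u : GLm p 2, (u : Mat p 2) 1 0 = 0 → (u : Mat p 2) 0 0 = 1 → (u : Mat p 2) 1 1 = 1 →
      u ∈ H₁)
    {s t : GLm p 2} (hs : s ∈ H₁) (hse : (s : Mat p 2) = !![e, 0; 0, 1]) (ht : t ∈ H₂)
    (htq : (t : Mat p 2) = !![1, 0; 0, q]) (htpp : SubgroupTPP H₁ H₂ H₃) :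
    ¬ ∃ c : Mat p 2 → ℂ, (∀ M, 1 < M.rank → c M = 0) ∧
        (∑ M, c M * ZMod.stdAddChar (Matrix.trace (M * ((1 : GLm p 2) : Mat p 2)))) = 1 ∧
        ∀ a ∈ H₁, ∀ b ∈ H₂, ∀ g ∈ H₃, a * b * g ≠ 1 →
          (∑ M, c M *
            ZMod.stdAddChar (Matrix.trace (M * ((a * b * g : GLm p 2) : Mat p 2)))) = 0 := by
  rintro ⟨c, hc, hc1, hc0⟩
  have hrect := rect_of_generators hs hse ht htq
  refine no_idTest_urect₁₂ htpp one_ne_zero he0 one_ne_zero hq0 (Ne.symm he1) (Ne.symm hq1)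
    (fun α β hα hβ x => ucell_of_left hU
      (by rcases hβ with hβ | hβ <;> rw [hβ]; exacts [one_ne_zero, hq0]) (hrect α β hα hβ) x)
    ⟨fourierFn c, fourierFn_mem_levelSubmodule hc, hc1, fun a ha b hb g hg hne => ?_⟩
  exact hc0 a ha b hb g hg hne

/-- **RECTANGLE LAW in the crux's vocabulary, partner `H₃`** — the frame survivor's pair
`(K₁, S)`: `K₁ ⊇ U⁺ ∪ {diag(-1, 1)}`, `S ∋ diag(1, q)`. -/
theorem no_levelOne_design_rect₁₃ {H₁ H₂ H₃ : Subgroup (GLm p 2)} {e q : ZMod p}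
    (he0 : e ≠ 0) (he1 : e ≠ 1) (hq0 : q ≠ 0) (hq1 : q ≠ 1)
    (hU : ∀ u : GLm p 2, (u : Mat p 2) 1 0 = 0 → (u : Mat p 2) 0 0 = 1 → (u : Mat p 2) 1 1 = 1 →
      u ∈ H₁)
    {s t : GLm p 2} (hs : s ∈ H₁) (hse : (s : Mat p 2) = !![e, 0; 0, 1]) (ht : t ∈ H₃)
    (htq : (t : Mat p 2) = !![1, 0; 0, q]) (htpp : SubgroupTPP H₁ H₂ H₃) :
    ¬ ∃ c : Mat p 2 → ℂ, (∀ M, 1 < M.rank → c M = 0) ∧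
        (∑ M, c M * ZMod.stdAddChar (Matrix.trace (M * ((1 : GLm p 2) : Mat p 2)))) = 1 ∧
        ∀ a ∈ H₁, ∀ b ∈ H₂, ∀ g ∈ H₃, a * b * g ≠ 1 →
          (∑ M, c M *
            ZMod.stdAddChar (Matrix.trace (M * ((a * b * g : GLm p 2) : Mat p 2)))) = 0 := by
  rintro ⟨c, hc, hc1, hc0⟩
  have hrect := rect_of_generators hs hse ht htq
  refine no_idTest_urect₁₃ htpp one_ne_zero he0 one_ne_zero hq0 (Ne.symm he1) (Ne.symm hq1)
    (fun α β hα hβ x => ucell_of_left hU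
      (by rcases hβ with hβ | hβ <;> rw [hβ]; exacts [one_ne_zero, hq0]) (hrect α β hα hβ) x)
    ⟨fourierFn c, fourierFn_mem_levelSubmodule hc, hc1, fun a ha b hb g hg hne => ?_⟩
  exact hc0 a ha b hb g hg hne

end RectangleLaw

end Summit.MatrixMultiplication.MatrixMultiplication.Theorems.SubgroupIdentityDesigns.Negative

end
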